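import Literature.MathematicalPhysics.QuantumFieldTheory.TorusChartCochains
import HarnessLib

/-!
# Flat `1`-cochains on charted tori are gradients plus seam (winding) cochains

The structure theorem for closed `1`-cochains on a discrete torus `Λ ≅ ∏ᵢ ℤ/N_iℤ` (any chart, any additive
abelian coefficient group `A`), i.e. the discrete de Rham statement `H¹(𝕋^d; A) ≅ A^d` with explicit
representatives:

* `TorusChart.seam w` — the **seam cochain** of a tuple `w : Fin d → A`: the edge `(x, i)` carries `w i` if it
  wraps around the torus (`x_i = N_i - 1`) and `0` otherwise (the additive form of Lüscher's constant abelian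
  potentials / torons); it is flat (`d₁_seam`).
* `TorusChart.wind θ i = Σ_{k < N_i} θ (k • e_i, i)` — the **winding** of `θ` along the `i`-th axis loop through the
  origin; `wind (d₀ f) = 0`, `wind (seam w) = w`; for flat `θ` it can be read along any axis line
  (`lineSum_period_eq_wind`).
* `eq_d₀_prim_add_seam_wind` (**structure theorem**): a flat `θ` equals `d₀ (prim θ) + seam (wind θ)`;
  `isFlat_iff_exists`: flat ⇔ `d₀ f + seam w` for some `f`, `w`; uniqueness
  (`d₀_add_seam_eq_d₀_add_seam_iff`: `w` is determined — it is the winding vector — and `f` up to an additive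
  constant; `d₀_eq_zero_iff`: zero gradient ⇔ constant); `exists_d₀_eq_iff`: gradients are exactly the flat
  cochains with zero winding vector; `seam_eq_d₀_iff`: non-zero seam cochains are not gradients.

Proof: by `d₀_prim_of_lt` the flat residual `θ - d₀ (prim θ)` vanishes on non-wrapping edges; a flat cochain
vanishing off the seams is constant along each seam (`apply_eq_of_wrap_of_vanish`, sliding across the
transverse directions one at a time), hence a seam cochain (`eq_seam_of_vanish`), whose tuple `wind` reads off.
This is the combinatorial core of the spin-wave / vortex decomposition of `XY`-type models on a torus
(`TorusChartSpinWaveLift.lean`).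
-/

namespace Literature.MathematicalPhysics.QuantumFieldTheory

open scoped BigOperators

namespace TorusChart

variable {Λ : Type*} [AddCommGroup Λ] {d : ℕ} (F : TorusChart Λ d)

variable {A : Type*} [AddCommGroup A]

/-! ## Seam cochains and windings -/

/-- The **seam cochain** of a tuple `w : Fin d → A`: the edge `(x, μ)` carries `w μ` if it wraps around the
torus (`x_μ = N_μ - 1`) and `0` otherwise — the additive form of Lüscher's constant abelian gauge
potentials / torons. [folklore] -/
def seam (w : Fin d → A) : Λ → Fin d → A :=
  fun x μ => if F.cval μ x + 1 = F.period μ then w μ else 0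

/-- Unfolding `seam`. [folklore] -/
@[simp] theorem seam_apply (w : Fin d → A) (x : Λ) (μ : Fin d) :
    F.seam w x μ = if F.cval μ x + 1 = F.period μ then w μ else 0 := rfl

/-- The value of a seam cochain on an edge `(x, μ)` only depends on `x_μ`: transverse unit steps do not change
it. [folklore] -/
theorem seam_add_gen_of_ne (w : Fin d → A) (x : Λ) {μ ν : Fin d} (hμν : μ ≠ ν) :
    F.seam w (x + F.gen ν) μ = F.seam w x μ := by
  simp only [seam_apply, F.cval_add_gen_of_ne x hμν]

/-- **Seam cochains are flat**: a plaquette contains either no wrapping edge in a given direction or two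
with opposite orientations. [folklore] -/
theorem d₁_seam (w : Fin d → A) : F.d₁ (F.seam w) = 0 := by
  funext x i j
  by_cases hij : i = j
  · subst hij; exact F.d₁_self _ x i
  rw [d₁_apply, F.seam_add_gen_of_ne w x (Ne.symm hij), F.seam_add_gen_of_ne w x hij, Pi.zero_apply,
    Pi.zero_apply, Pi.zero_apply]
  abel

/-- Seam cochains are flat. [folklore] -/
theorem isFlat_seam (w : Fin d → A) : F.IsFlat (F.seam w) := fun x i j => by rw [d₁_seam]; rfl

/-- `seam` is additive. [folklore] -/
theorem seam_add (w w' : Fin d → A) : F.seam (w + w') = F.seam w + F.seam w' := by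
  funext x μ; simp only [seam_apply, Pi.add_apply]; split_ifs <;> simp

/-- The seam cochain of the zero tuple vanishes. [folklore] -/
@[simp] theorem seam_zero : F.seam (0 : Fin d → A) = 0 := by
  funext x μ; simp

/-- A seam cochain vanishes on non-wrapping edges. [folklore] -/
theorem seam_of_lt (w : Fin d → A) (x : Λ) (μ : Fin d) (hx : F.cval μ x + 1 < F.period μ) : F.seam w x μ = 0 := by
  rw [seam_apply, if_neg hx.ne]

/-- A seam cochain takes the value `w μ` on wrapping `μ`-edges. [folklore] -/
theorem seam_of_eq (w : Fin d → A) (x : Λ) (μ : Fin d) (hx : F.cval μ x + 1 = F.period μ) : F.seam w x μ = w μ := by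
  rw [seam_apply, if_pos hx]

/-- The **winding** of a `1`-cochain along direction `μ`: its sum around the `μ`-th axis loop through the
origin, `wind θ μ = Σ_{k < N_μ} θ (k • e_μ, μ)`. [folklore] -/
def wind (θ : Λ → Fin d → A) (μ : Fin d) : A := F.lineSum θ μ (F.period μ) 0

/-- Unfolding `wind`. [folklore] -/
theorem wind_eq (θ : Λ → Fin d → A) (μ : Fin d) : F.wind θ μ = F.lineSum θ μ (F.period μ) 0 := rfl

/-- `wind` is additive. [folklore] -/
theorem wind_add (θ η : Λ → Fin d → A) : F.wind (θ + η) = F.wind θ + F.wind η := by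
  funext μ; exact F.lineSum_add θ η μ _ 0

/-- `wind` is subtractive. [folklore] -/
theorem wind_sub (θ η : Λ → Fin d → A) : F.wind (θ - η) = F.wind θ - F.wind η := by
  funext μ; exact F.lineSum_sub θ η μ _ 0

/-- The zero cochain has no winding. [folklore] -/
@[simp] theorem wind_zero : F.wind (0 : Λ → Fin d → A) = 0 := by
  funext μ; simp [wind_eq, lineSum]

/-- **Gradients have no winding** (the axis loop closes up). [folklore] -/
@[simp] theorem wind_d₀ (f : Λ → A) : F.wind (F.d₀ f) = 0 := by
  funext μ
  rw [wind_eq, lineSum_d₀, zero_add, F.period_nsmul_gen, Pi.zero_apply, sub_self]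

/-- **The winding of a seam cochain is its tuple**: the axis loop through the origin crosses the seam exactly
once. [folklore] -/
@[simp] theorem wind_seam (w : Fin d → A) : F.wind (F.seam w) = w := by
  funext μ
  rw [wind_eq, lineSum]
  have hN := F.period_pos μ
  calc ∑ k ∈ Finset.range (F.period μ), F.seam w (0 + k • F.gen μ) μ
      = ∑ k ∈ Finset.range (F.period μ), (if k = F.period μ - 1 then w μ else 0) := by
        refine Finset.sum_congr rfl fun k hk => ?_
        rw [Finset.mem_range] at hk
        rw [zero_add, seam_apply, F.cval_nsmul_gen_self_of_lt μ hk]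
        by_cases h : k = F.period μ - 1
        · rw [if_pos h, if_pos (by omega)]
        · rw [if_neg h, if_neg (by omega)]
    _ = w μ := by
        rw [Finset.sum_ite_eq']
        rw [if_pos (Finset.mem_range.2 (Nat.sub_lt hN Nat.one_pos))]

variable {F} in
/-- For a flat cochain the winding can be read along ANY axis line, not just the one through the origin.
[folklore] -/
theorem lineSum_period_eq_wind {θ : Λ → Fin d → A} (hθ : F.IsFlat θ) (μ : Fin d) (y : Λ) :
    F.lineSum θ μ (F.period μ) y = F.wind θ μ :=
  F.lineSum_period_eq hθ μ y

section Map

variable {B : Type*} [AddCommGroup B] (g : A →+ B)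

/-- Seam cochains commute with a change of coefficients. [folklore] -/
theorem map_seam (w : Fin d → A) (x : Λ) (μ : Fin d) : g (F.seam w x μ) = F.seam (fun ν => g (w ν)) x μ := by
  simp only [seam_apply]; split_ifs <;> simp

/-- Windings commute with a change of coefficients. [folklore] -/
theorem map_wind (θ : Λ → Fin d → A) (μ : Fin d) : g (F.wind θ μ) = F.wind (fun z k => g (θ z k)) μ :=
  F.map_lineSum g θ μ _ 0

end Map

/-! ## Cochains supported on the seams -/

variable {F} in
/-- In a flat cochain whose `ν`-edges at `y` and `y + e_μ` vanish, the `μ`-edge is unchanged under the unit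
step `e_ν`. [folklore] -/
theorem apply_add_gen_eq_of_isFlat {ρ : Λ → Fin d → A} (hρ : F.IsFlat ρ) (y : Λ) (μ ν : Fin d)
    (h1 : ρ y ν = 0) (h2 : ρ (y + F.gen μ) ν = 0) : ρ (y + F.gen ν) μ = ρ y μ := by
  have h := hρ.add_eq_add y μ ν
  rw [h2, h1, add_zero, zero_add] at h
  exact h.symm

variable {F} in
/-- Zeroing one transverse coordinate: for a flat `ρ` vanishing on all non-wrapping edges, a direction
`ν ≠ μ` and a site `z` with `z_ν = 0`, the value `ρ (z + j • e_ν, μ)` does not depend on `j < N_ν`.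
[folklore] -/
theorem apply_add_nsmul_gen_eq_of_vanish {ρ : Λ → Fin d → A} (hρ : F.IsFlat ρ)
    (hvan : ∀ y ν, F.cval ν y + 1 < F.period ν → ρ y ν = 0) (z : Λ) {μ ν : Fin d} (hμν : μ ≠ ν)
    (hz : F.cval ν z = 0) : ∀ j : ℕ, j + 1 ≤ F.period ν → ρ (z + j • F.gen ν) μ = ρ z μ
  | 0, _ => by simp
  | j + 1, hj => by
    have IH := apply_add_nsmul_gen_eq_of_vanish hρ hvan z hμν hz j (by omega)
    rw [← IH, succ_nsmul, ← add_assoc]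
    have hyν : F.cval ν (z + j • F.gen ν) = j := by
      rw [F.cval_add_nsmul_gen_self, hz, zero_add, Nat.mod_eq_of_lt (by omega)]
    refine apply_add_gen_eq_of_isFlat hρ _ μ ν (hvan _ ν (by rw [hyν]; omega)) (hvan _ ν ?_)
    rw [F.cval_add_gen_of_ne _ (Ne.symm hμν), hyν]; omega

variable {F} in
/-- Zeroing the first `k` transverse coordinates of a site does not change the value of a flat,
seam-supported cochain on its `μ`-edge. [folklore] -/
theorem apply_eq_apply_site_of_vanish {ρ : Λ → Fin d → A} (hρ : F.IsFlat ρ)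
    (hvan : ∀ y ν, F.cval ν y + 1 < F.period ν → ρ y ν = 0) (x : Λ) (μ : Fin d) :
    ∀ k : ℕ, ρ x μ = ρ (F.site fun i => if (i : ℕ) < k ∧ i ≠ μ then 0 else F.cval i x) μ
  | 0 => by simp [site_cval]
  | k + 1 => by
    rw [apply_eq_apply_site_of_vanish hρ hvan x μ k]
    have hred : ∀ (P : Fin d → Prop) [DecidablePred P] (j : Fin d),
        (if P j then 0 else F.cval j x) < F.period j := fun P _ j => by
      split_ifs
      · exact F.period_pos j
      · exact F.cval_lt j x
    by_cases hkd : k < d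
    · obtain ⟨κ, hκk⟩ : ∃ κ : Fin d, (κ : ℕ) = k := ⟨⟨k, hkd⟩, rfl⟩
      by_cases hκμ : κ = μ
      · -- coordinate `k` is the seam direction itself: nothing to zero
        congr 2
        funext i
        by_cases hi : i = μ
        · subst hi; simp
        · have : ((i : ℕ) < k ∧ i ≠ μ) ↔ ((i : ℕ) < k + 1 ∧ i ≠ μ) := by
            constructor
            · rintro ⟨h, h'⟩; exact ⟨Nat.lt_succ_of_lt h, h'⟩
            · rintro ⟨h, h'⟩
              refine ⟨lt_of_le_of_ne (Nat.le_of_lt_succ h) fun hik => hi ?_, h'⟩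
              rw [← hκμ]; exact Fin.ext (hik.trans hκk.symm)
          simp only [this]
      · -- zero coordinate `κ ≠ μ` by sliding along `κ`
        set z : Λ := F.site fun i => if (i : ℕ) < k + 1 ∧ i ≠ μ then 0 else F.cval i x with hz
        set w : Λ := F.site fun i => if (i : ℕ) < k ∧ i ≠ μ then 0 else F.cval i x with hw
        have hzκ : F.cval κ z = 0 := by
          rw [hz, F.cval_site (hred _)]
          simp [hκμ, hκk]
        have hwz : w = z + F.cval κ x • F.gen κ := by
          refine F.ext_cval fun i => ?_
          rw [hw, hz, F.cval_site (hred _), F.cval_add_nsmul_gen, F.cval_site (hred _)]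
          by_cases hiκ : i = κ
          · subst hiκ
            simp [hκμ, hκk, Nat.mod_eq_of_lt (F.cval_lt i x)]
          · have hik : (i : ℕ) ≠ k := fun h => hiκ (Fin.ext (h.trans hκk.symm))
            have : ((i : ℕ) < k ∧ i ≠ μ) ↔ ((i : ℕ) < k + 1 ∧ i ≠ μ) := by
              constructor
              · rintro ⟨h, h'⟩; exact ⟨Nat.lt_succ_of_lt h, h'⟩
              · rintro ⟨h, h'⟩; exact ⟨by omega, h'⟩
            simp only [this, hiκ, if_false]
        change ρ w μ = ρ z μ
        rw [hwz]
        exact apply_add_nsmul_gen_eq_of_vanish hρ hvan z (Ne.symm hκμ) hzκ (F.cval κ x)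
          (Nat.succ_le_of_lt (F.cval_lt κ x))
    · congr 2
      funext i
      have : ((i : ℕ) < k ∧ i ≠ μ) ↔ ((i : ℕ) < k + 1 ∧ i ≠ μ) := by
        have := i.isLt
        constructor
        · rintro ⟨h, h'⟩; exact ⟨Nat.lt_succ_of_lt h, h'⟩
        · rintro ⟨_, h'⟩; exact ⟨by omega, h'⟩
      simp only [this]

variable {F} in
/-- **A flat cochain supported on the seams is constant along each seam**: on a wrapping `μ`-edge its value
is the value at the reference wrapping edge `((N_μ - 1) • e_μ, μ)`. [folklore] -/
theorem apply_eq_of_wrap_of_vanish {ρ : Λ → Fin d → A} (hρ : F.IsFlat ρ)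
    (hvan : ∀ y ν, F.cval ν y + 1 < F.period ν → ρ y ν = 0) (x : Λ) (μ : Fin d)
    (hx : F.cval μ x + 1 = F.period μ) : ρ x μ = ρ ((F.period μ - 1) • F.gen μ) μ := by
  rw [apply_eq_apply_site_of_vanish hρ hvan x μ d]
  congr 2
  refine F.ext_cval fun i => ?_
  have hred : ∀ j : Fin d, (if (j : ℕ) < d ∧ j ≠ μ then 0 else F.cval j x) < F.period j := fun j => by
    split_ifs
    · exact F.period_pos j
    · exact F.cval_lt j x
  rw [F.cval_site hred]
  by_cases hi : i = μ
  · subst hi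
    rw [F.cval_nsmul_gen_self_of_lt i (Nat.sub_lt (F.period_pos i) Nat.one_pos)]
    simp only [ne_eq, not_true_eq_false, and_false, if_false]
    omega
  · rw [F.cval_nsmul_gen_of_ne hi]
    simp [i.isLt, hi]

variable {F} in
/-- **A flat cochain supported on the seams is a seam cochain.** [folklore] -/
theorem eq_seam_of_vanish {ρ : Λ → Fin d → A} (hρ : F.IsFlat ρ)
    (hvan : ∀ y ν, F.cval ν y + 1 < F.period ν → ρ y ν = 0) :
    ρ = F.seam fun μ => ρ ((F.period μ - 1) • F.gen μ) μ := by
  funext x μ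
  rw [seam_apply]
  split_ifs with hx
  · exact apply_eq_of_wrap_of_vanish hρ hvan x μ hx
  · exact hvan x μ (lt_of_le_of_ne (Nat.succ_le_of_lt (F.cval_lt μ x)) hx)

/-! ## The structure theorem -/

variable {F} in
/-- **Flat cochains are gradients plus seam cochains** (existence, with the axial primitive): for a flat `θ`,
`θ = d₀ (prim θ) + seam w` with `w` the seam values of the residual. [folklore] -/
theorem eq_d₀_prim_add_seam {θ : Λ → Fin d → A} (hθ : F.IsFlat θ) :
    θ = F.d₀ (F.prim θ) + F.seam fun μ => (θ - F.d₀ (F.prim θ)) ((F.period μ - 1) • F.gen μ) μ := by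
  have hρ : F.IsFlat (θ - F.d₀ (F.prim θ)) := hθ.sub (F.isFlat_d₀ _)
  have hvan : ∀ y ν, F.cval ν y + 1 < F.period ν → (θ - F.d₀ (F.prim θ)) y ν = 0 := fun y ν hy => by
    rw [Pi.sub_apply, Pi.sub_apply, d₀_prim_of_lt hθ y ν hy, sub_self]
  have h := eq_seam_of_vanish hρ hvan
  rw [← h, add_sub_cancel]

variable {F} in
/-- **The tuple of a flat cochain is its winding vector**: `θ = d₀ (prim θ) + seam (wind θ)` for every flat `θ`
(discrete de Rham in degree one on the torus, with explicit representatives). [folklore] -/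
theorem eq_d₀_prim_add_seam_wind {θ : Λ → Fin d → A} (hθ : F.IsFlat θ) :
    θ = F.d₀ (F.prim θ) + F.seam (F.wind θ) := by
  have h := eq_d₀_prim_add_seam hθ
  have hw : F.wind θ = fun μ => (θ - F.d₀ (F.prim θ)) ((F.period μ - 1) • F.gen μ) μ := by
    conv_lhs => rw [h]
    rw [wind_add, wind_d₀, zero_add, wind_seam]
  rw [hw]
  exact h

/-- **Flat ⇔ gradient plus seam cochain.** [folklore] -/
theorem isFlat_iff_exists (θ : Λ → Fin d → A) :
    F.IsFlat θ ↔ ∃ (f : Λ → A) (w : Fin d → A), θ = F.d₀ f + F.seam w := by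
  refine ⟨fun hθ => ⟨F.prim θ, F.wind θ, eq_d₀_prim_add_seam_wind hθ⟩, ?_⟩
  rintro ⟨f, w, rfl⟩
  exact (F.isFlat_d₀ f).add (F.isFlat_seam w)

/-- The winding vector of a gradient plus a seam cochain is the seam tuple. [folklore] -/
theorem wind_d₀_add_seam (f : Λ → A) (w : Fin d → A) : F.wind (F.d₀ f + F.seam w) = w := by
  rw [wind_add, wind_d₀, wind_seam, zero_add]

/-- **A `0`-cochain with zero gradient is constant** (the torus is connected by unit steps). [folklore] -/
theorem d₀_eq_zero_iff (f : Λ → A) : F.d₀ f = 0 ↔ ∀ x, f x = f 0 := by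
  constructor
  · intro hf x
    have hstep : ∀ (y : Λ) (i : Fin d), f (y + F.gen i) = f y := fun y i => by
      have := congr_fun (congr_fun hf y) i
      rwa [d₀_apply, Pi.zero_apply, Pi.zero_apply, sub_eq_zero] at this
    have hline : ∀ (y : Λ) (i : Fin d) (n : ℕ), f (y + n • F.gen i) = f y := fun y i n => by
      induction n with
      | zero => simp
      | succ n ih => rw [succ_nsmul, ← add_assoc, hstep, ih]
    rw [F.eq_sum_cval_nsmul_gen x]
    induction (Finset.univ : Finset (Fin d)) using Finset.induction_on with
    | empty => simp
    | insert a s ha ih => rw [Finset.sum_insert ha, add_comm, ← zero_add (_ + _), ← add_assoc, hline, zero_add, ih]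
  · intro hf
    funext x i
    rw [d₀_apply, hf (x + F.gen i), hf x, sub_self, Pi.zero_apply, Pi.zero_apply]

/-- **Uniqueness of the decomposition**: the seam tuple of a flat cochain is determined (it is the winding
vector) and the primitive is determined up to an additive constant. [folklore] -/
theorem d₀_add_seam_eq_d₀_add_seam_iff (f f' : Λ → A) (w w' : Fin d → A) :
    F.d₀ f + F.seam w = F.d₀ f' + F.seam w' ↔ w = w' ∧ ∀ x, f x - f' x = f 0 - f' 0 := by
  constructor
  · intro h
    have hw : w = w' := by
      have := congr_arg F.wind h
      rwa [wind_d₀_add_seam, wind_d₀_add_seam] at this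
    subst hw
    refine ⟨rfl, ?_⟩
    have hd : F.d₀ (f - f') = 0 := by
      rw [d₀_sub]; exact sub_eq_zero.2 (add_right_cancel h)
    intro x
    have := (F.d₀_eq_zero_iff (f - f')).1 hd x
    simpa using this
  · rintro ⟨rfl, hf⟩
    have hd : F.d₀ f = F.d₀ f' := by
      have h0 : F.d₀ (f - f') = 0 :=
        (F.d₀_eq_zero_iff (f - f')).2 fun x => by simpa using hf x
      rwa [d₀_sub, sub_eq_zero] at h0
    rw [hd]

/-- Any primitive of a flat cochain differs from the axial primitive by a constant, and its seam tuple is the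
winding vector. [folklore] -/
theorem eq_wind_and_eq_prim_add_of_eq {θ : Λ → Fin d → A} {f : Λ → A} {w : Fin d → A}
    (h : θ = F.d₀ f + F.seam w) : w = F.wind θ ∧ ∀ x, f x = F.prim θ x + f 0 := by
  have hθ : F.IsFlat θ := (F.isFlat_iff_exists θ).2 ⟨f, w, h⟩
  have h' := h.symm.trans (eq_d₀_prim_add_seam_wind hθ)
  obtain ⟨hw, hf⟩ := (F.d₀_add_seam_eq_d₀_add_seam_iff f (F.prim θ) w (F.wind θ)).1 h'
  refine ⟨hw, fun x => ?_⟩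
  have := hf x
  rw [prim_origin, sub_zero] at this
  exact sub_eq_iff_eq_add'.1 this

/-- **Gradients = flat cochains with zero winding** (`H¹` of the torus is detected by the windings).
[folklore] -/
theorem exists_d₀_eq_iff (θ : Λ → Fin d → A) : (∃ f : Λ → A, θ = F.d₀ f) ↔ F.IsFlat θ ∧ F.wind θ = 0 := by
  constructor
  · rintro ⟨f, rfl⟩
    exact ⟨F.isFlat_d₀ f, F.wind_d₀ f⟩
  · rintro ⟨hθ, hw⟩
    refine ⟨F.prim θ, ?_⟩
    have h := eq_d₀_prim_add_seam_wind hθ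
    rwa [hw, seam_zero, add_zero] at h

variable {F} in
/-- A flat cochain with zero winding vector is the gradient of its axial primitive. [folklore] -/
theorem eq_d₀_prim_of_wind_eq_zero {θ : Λ → Fin d → A} (hθ : F.IsFlat θ) (hw : F.wind θ = 0) :
    θ = F.d₀ (F.prim θ) := by
  have h := eq_d₀_prim_add_seam_wind hθ
  rwa [hw, seam_zero, add_zero] at h

/-- **The axial primitive of a gradient recovers the function** up to its value at the origin:
`prim (d₀ f) x = f x - f 0`. [folklore] -/
theorem prim_d₀ (f : Λ → A) (x : Λ) : F.prim (F.d₀ f) x = f x - f 0 := by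
  have h := (F.eq_wind_and_eq_prim_add_of_eq (θ := F.d₀ f) (f := f) (w := 0)
    (by rw [seam_zero, add_zero])).2 x
  rw [h, add_sub_cancel_right]

/-- **Seam cochains are never gradients** unless trivial: `seam w = d₀ f` forces `w = 0`. [folklore] -/
theorem seam_eq_d₀_iff (w : Fin d → A) (f : Λ → A) : F.seam w = F.d₀ f ↔ w = 0 ∧ F.d₀ f = 0 := by
  constructor
  · intro h
    have hw : w = 0 := by
      have := congr_arg F.wind h
      rwa [wind_seam, wind_d₀] at this
    subst hw
    exact ⟨rfl, by rw [← h, seam_zero]⟩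
  · rintro ⟨rfl, hf⟩
    rw [seam_zero, hf]


end TorusChart

end Literature.MathematicalPhysics.QuantumFieldTheory
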